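import Literature.AlgebraicGeometry.Limits.LocalizationOpenDescent
import Mathlib.AlgebraicGeometry.Morphisms.Proper
import Mathlib.AlgebraicGeometry.Morphisms.Flat
import Mathlib.AlgebraicGeometry.Morphisms.UniversallyOpen
import HarnessLib

/-!
# Limits of schemes: properness spreads out from the generic fibre, given a proper cover (Stacks 081F)

Topic: `Literature/AlgebraicGeometry/Limits`; sequel of `Limits/LocalizationProdLimit`
(`Spec Frac A = lim_s Spec A[1/s]` for a domain `A`, Stacks 01ZC). Stacks, Tag 081F
(EGA IV₃ 8.10.5 (xii)): if `X → Y = lim Yᵢ` is proper then so is some model `Xᵢ → Yᵢ`. Its proof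
passes through Chow's lemma: a proper `Yᵢ`-scheme surjecting onto `Xᵢ` makes `Xᵢ → Yᵢ`
universally closed. This file proves that final step in the form needed to spread out an abelian
variety (`Literature.NumberTheory.EllipticCurves.NeronModelExistenceProofs`), for the localization
diagram of a domain `A` with `B = A_S`, `S ⊆ A ∖ {0}`:

* `LocApprox.isProper_snd_of_generic_cover` — let `Y → Spec A` be **proper**, `P → Spec A` locally
  of finite presentation, `t ∈ S` a stage over which `P_t = P ×_A Spec A[1/t] → Spec A[1/t]` is
  flat and separated, `g : Y ⊗ Spec A[1/t] → P` an `A`-morphism whose restriction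
  `a : Y ⊗ Spec B → P` to `Spec B` is *surjective onto `P ⊗ Spec B`* (as the `B`-morphism
  `(a, pr₂)`). Then `P_t → Spec A[1/t]` is proper. Proof: `(g, pr₂) : Y ⊗ Spec A[1/t] → P_t` is
  proper (source proper, target separated over `A[1/t]`), so its image `Z` is closed; the image
  in `Spec A` of the open complement of `Z` is open (`P_t → Spec A` is flat and locally of finite
  presentation, hence open — Mathlib `UniversallyOpen.of_flat`) and misses the generic point
  (points of `P_t` over the generic point come from `P ⊗ Spec B`, which is covered by
  `Y ⊗ Spec B`), hence is empty: `(g, pr₂)` is surjective and `P_t → Spec A[1/t]` is universally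
  closed (Mathlib `UniversallyClosed.of_comp_surjective`), separated and of finite type.

## References

* The Stacks project, Tag 081F (whose proof goes through Chow's lemma). [StacksProject]
* A. Grothendieck, EGA IV₃, Thm. 8.10.5 (xii) (Publ. Math. IHÉS 28, 1966). [EGAIV3]
-/

noncomputable section

universe u

open CategoryTheory CategoryTheory.Limits AlgebraicGeometry MonoidalCategory
  CartesianMonoidalCategory

namespace Literature.AlgebraicGeometry.Limits

namespace LocApprox

open Literature.AlgebraicGeometry.Motives (SchemeOver specOver)

set_option backward.isDefEq.respectTransparency false

variable {A : Type u} [CommRing A] [IsDomain A] (S : Submonoid A) (B : Type u) [CommRing B]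
  [Algebra A B] [IsLocalization S B]

/-- In the spectrum of a domain, the generic point `(0)` lies in every non-empty open subset. [folklore] -/
theorem bot_mem_of_isOpen_of_mem {U : Set (PrimeSpectrum A)} (hU : IsOpen U) {x : PrimeSpectrum A}
    (hx : x ∈ U) : (⊥ : PrimeSpectrum A) ∈ U := by
  have hcl : x ∈ closure {(⊥ : PrimeSpectrum A)} :=
    (PrimeSpectrum.le_iff_mem_closure ⊥ x).mp bot_le
  obtain ⟨y, hyU, hy⟩ := mem_closure_iff.mp hcl U hU hx
  rw [Set.mem_singleton_iff] at hy
  rwa [hy] at hyU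

/-- For `S ⊆ A ∖ {0}` (`A` a domain), `Spec A_S → Spec A` hits the generic point: it is the image
of the generic point of `Spec A_S`. [folklore] -/
theorem exists_specOver_hom_apply_eq_bot (hS : S ≤ nonZeroDivisors A) :
    ∃ η : (specOver A B).left, (specOver A B).hom η = (⊥ : PrimeSpectrum A) := by
  haveI : IsDomain B := IsLocalization.isDomain_of_le_nonZeroDivisors B hS
  refine ⟨(⟨⊥, Ideal.isPrime_bot⟩ : PrimeSpectrum B), ?_⟩
  change Spec.map (CommRingCat.ofHom (algebraMap A B)) _ = _
  rw [Spec.map_apply]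
  exact PrimeSpectrum.ext (Ideal.comap_bot_of_injective _ (IsLocalization.injective B hS))

variable {S B}

/-- **Points of a stage `P ⊗ Spec A[1/t]` over the generic point of `Spec A` come from
`P ⊗ Spec B`.** (The projection `P ⊗ Spec A[1/t] → P` is an open immersion, hence injective, and
`P ⊗ Spec B → P` hits every point of `P` over the generic point.) [folklore] -/
theorem exists_whiskerLeft_leg_apply_eq (hS : S ≤ nonZeroDivisors A) (P : SchemeOver A) (t : Idx S)
    (p : (P ⊗ (baseDiagram S).obj t).left)
    (hp : (P ⊗ (baseDiagram S).obj t).hom p = (⊥ : PrimeSpectrum A)) :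
    ∃ q : (P ⊗ specOver A B).left, (P ◁ leg S B t).left q = p := by
  obtain ⟨η, hη⟩ := exists_specOver_hom_apply_eq_bot S B hS
  have hx : P.hom (pullback.fst P.hom ((baseDiagram S).obj t).hom p) = (specOver A B).hom η := by
    rw [hη, ← Scheme.Hom.comp_apply]
    exact hp
  obtain ⟨q, hq, -⟩ := Scheme.Pullback.exists_preimage_pullback _ _ hx
  refine ⟨q, (pullback.fst P.hom ((baseDiagram S).obj t).hom).isOpenEmbedding.injective ?_⟩
  change ((P ◁ leg S B t).left ≫ pullback.fst P.hom ((baseDiagram S).obj t).hom) q = _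
  rw [Over.whiskerLeft_left_fst]
  exact hq

omit [IsDomain A] in
/-- The pairing `(g, pr₂) : Y ⊗ T → P ⊗ T` of an `A`-morphism `g : Y ⊗ T → P` with the
projection; restricted along `T' → T` it is the pairing of the restriction. [folklore] -/
theorem whiskerLeft_comp_lift_snd {Y P T T' : SchemeOver A} (ℓ : T' ⟶ T) (g : Y ⊗ T ⟶ P) :
    (Y ◁ ℓ) ≫ lift g (snd Y T) = lift ((Y ◁ ℓ) ≫ g) (snd Y T') ≫ (P ◁ ℓ) := by
  refine CartesianMonoidalCategory.hom_ext _ _ ?_ ?_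
  · simp only [Category.assoc, lift_fst, whiskerLeft_fst]
  · simp only [Category.assoc, lift_snd, whiskerLeft_snd, lift_snd_assoc]

/-- **Properness spreads out along a proper generic cover** (the last step of Stacks 081F). Let
`A` be a domain, `B = A_S` with `S ⊆ A ∖ {0}`, `Y → Spec A` proper, `P → Spec A` locally of finite
presentation, `t ∈ S` with `P ⊗ Spec A[1/t] → Spec A[1/t]` flat and separated, and
`g : Y ⊗ Spec A[1/t] → P` over `A` such that the pairing `(a, pr₂) : Y ⊗ Spec B → P ⊗ Spec B` of
its restriction `a = g|_{Spec B}` is surjective. Then `P ⊗ Spec A[1/t] → Spec A[1/t]` is proper.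
[cite: StacksProject, Tag 081F] [cite: EGAIV3, Thm. 8.10.5 (xii)] -/
theorem isProper_snd_of_generic_cover (hS : S ≤ nonZeroDivisors A) (Y P : SchemeOver A)
    [IsProper Y.hom] [LocallyOfFinitePresentation P.hom] (t : Idx S)
    [Flat (pullback.snd P.hom ((baseDiagram S).obj t).hom)]
    [IsSeparated (pullback.snd P.hom ((baseDiagram S).obj t).hom)]
    (g : Y ⊗ (baseDiagram S).obj t ⟶ P)
    (ha : Function.Surjective (lift ((Y ◁ leg S B t) ≫ g) (snd Y (specOver A B))).left) :
    IsProper (pullback.snd P.hom ((baseDiagram S).obj t).hom) := by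
  set g' : Y ⊗ (baseDiagram S).obj t ⟶ P ⊗ (baseDiagram S).obj t :=
    lift g (snd Y ((baseDiagram S).obj t)) with hg'
  -- `(g, pr₂)` is proper: its composite with the separated `P ⊗ T → T` is the proper `Y ⊗ T → T`
  have hcomp : g'.left ≫ pullback.snd P.hom ((baseDiagram S).obj t).hom =
      pullback.snd Y.hom ((baseDiagram S).obj t).hom := by
    rw [hg', Over.lift_left]
    exact pullback.lift_snd _ _ _
  haveI : IsProper (pullback.snd Y.hom ((baseDiagram S).obj t).hom) :=
    MorphismProperty.pullback_snd _ _ inferInstance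
  haveI : IsProper (g'.left ≫ pullback.snd P.hom ((baseDiagram S).obj t).hom) := by
    rw [hcomp]; infer_instance
  haveI : IsProper g'.left := IsProper.of_comp g'.left (pullback.snd P.hom ((baseDiagram S).obj t).hom)
  -- hence its image is closed; the complement maps onto an open subset of `Spec A`
  have hZ : IsClosed (Set.range g'.left) := g'.left.isClosedMap.isClosed_range
  haveI : UniversallyOpen (pullback.snd P.hom ((baseDiagram S).obj t).hom ≫ ((baseDiagram S).obj t).hom) :=
    inferInstance
  have hopen : IsOpen ((pullback.snd P.hom ((baseDiagram S).obj t).hom ≫ ((baseDiagram S).obj t).hom) ''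
      (Set.range g'.left)ᶜ) :=
    (pullback.snd P.hom ((baseDiagram S).obj t).hom ≫ ((baseDiagram S).obj t).hom).isOpenMap _
      hZ.isOpen_compl
  -- which misses the generic point, hence is empty: `(g, pr₂)` is surjective
  have hsurj : Function.Surjective g'.left := by
    intro p
    by_contra hp
    have hmem : (pullback.snd P.hom ((baseDiagram S).obj t).hom ≫ ((baseDiagram S).obj t).hom) p ∈
        (pullback.snd P.hom ((baseDiagram S).obj t).hom ≫ ((baseDiagram S).obj t).hom) ''
          (Set.range g'.left)ᶜ :=
      ⟨p, fun ⟨y, hy⟩ => hp ⟨y, hy⟩, rfl⟩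
    obtain ⟨p', hp', hbot⟩ := bot_mem_of_isOpen_of_mem hopen hmem
    have hbot' : (P ⊗ (baseDiagram S).obj t).hom p' = (⊥ : PrimeSpectrum A) := by
      rw [Over.tensorObj_hom, pullback.condition]
      exact hbot
    obtain ⟨q, hq⟩ := exists_whiskerLeft_leg_apply_eq (B := B) hS P t p' hbot'
    obtain ⟨y, hy⟩ := ha q
    apply hp'
    refine ⟨(Y ◁ leg S B t).left y, ?_⟩
    have key : (Y ◁ leg S B t) ≫ g' =
        lift ((Y ◁ leg S B t) ≫ g) (snd Y (specOver A B)) ≫ (P ◁ leg S B t) := by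
      rw [hg']
      exact whiskerLeft_comp_lift_snd _ _
    have key' := congrArg (fun k : Y ⊗ specOver A B ⟶ P ⊗ (baseDiagram S).obj t => k.left y) key
    simp only [Over.comp_left, Scheme.Hom.comp_apply] at key'
    rw [key', hy]
    exact hq
  haveI : Surjective g'.left := ⟨hsurj⟩
  -- so `P ⊗ T → T` is universally closed, separated and locally of finite type: proper
  haveI : UniversallyClosed (g'.left ≫ pullback.snd P.hom ((baseDiagram S).obj t).hom) := by
    rw [hcomp]; infer_instance
  haveI : UniversallyClosed (pullback.snd P.hom ((baseDiagram S).obj t).hom) :=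
    UniversallyClosed.of_comp_surjective g'.left _
  exact ⟨⟩

end LocApprox

end Literature.AlgebraicGeometry.Limits

end
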